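import Summits.AtomisticToContinuum.HydrodynamicLimit.Theses.OneFlightGossipEngine
import Summits.AtomisticToContinuum.HydrodynamicLimit.Theses.WarmColdDichotomy
import Summits.AtomisticToContinuum.HydrodynamicLimit.Theorems.JParityClosureOddContactSymmetryGibbsInvariance
import Summits.AtomisticToContinuum.HydrodynamicLimit.Theorems.OneFlightGossipEngineEnergyCurrentTailsTagging
import Summits.AtomisticToContinuum.HydrodynamicLimit.Theorems.OneFlightGossipEngineEnergyCurrentTailsDocking
import Summits.AtomisticToContinuum.HydrodynamicLimit.Theorems.OneFlightGossipEngineEnergyCurrentTailsExergyInitial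
import Summits.AtomisticToContinuum.HydrodynamicLimit.Theorems.OneFlightGossipEngineEnergyCurrentTailsEquilibrium
import Summits.AtomisticToContinuum.HydrodynamicLimit.Theorems.OneFlightGossipEngineEnergyCurrentTailsMarginalForm
import Summits.AtomisticToContinuum.HydrodynamicLimit.Theorems.OneFlightGossipEngineEnergyCurrentTailsQuarticDocking
import Literature.MathematicalPhysics.KineticTheory.HardSphereTwoTimePressure
import Literature.MathematicalPhysics.KineticTheory.HardSphereEulerProofs

/-!
# Line `IdeatorThreeSketch` (card `loschmidt-tagging-exergy`) for the crux `EnergyCurrentTails`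
# (stmt-AtomisticToContinuum-9235) — registered skeleton, cycle 1 (reshaped)

Route `OneFlightGossipEngine` (rank 9); the decl is shared verbatim by WarmColdDichotomy (the item's
primary copy), BallwiseInvariantReferences, AnosovDiceHopf.  The crux, read back: for continuous
profiles `a₀, θ₀ > 0`, `u₀` there is `σ₀ > 0` such that for `0 < σ < σ₀`, every classical hs-Euler
solution on `[0,T)`, every flow family `Φ N` and local Gibbs data `λ_N` whose fields converge at `t = 0`:
`∀ t < T ∀ ε > 0 ∃ M ∃ N₀ ∀ N ≥ N₀ ∀ s ∈ [0,t], E_{λ_N}[(N+1)⁻¹ ∑ᵢ 𝟙{M < |vᵢ(s)|}|vᵢ(s)|³] ≤ ε`.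

## The lever (card A of `IdeatorThreeSketch.lean`, ideator 3)

Two exact symmetries of the hard-sphere flow — STATIONARITY of the homogeneous Gibbs law
`G = localGibbsLaw σ a 0 θr` under every `Φ_t` (`Theorems.measurePreserving_flow_localGibbsLaw_const`)
and REVERSIBILITY `Φ_t ∘ flip = flip ∘ Φ_{-t}` a.e. (`ae_flow_flipVel_localGibbsLaw`) — give the
LOSCHMIDT TAGGING IDENTITY (stub 1, landed): for every density `F ≥ 0` and one-particle `g ≥ 0`,
`∫ g(vᵢ) F(flip(Φ_s z)) dG = E_{F·G}[g(−vᵢ(s))]` (`stub_tagging`, even `g`;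
`lintegral_mul_density_flipVel_flow`, general `g`).  With `F = dλ_N/dG` the non-equilibrium sits in
ONE explicit weight under the INVARIANT law, and every a-priori velocity statement about the evolved
law has a G-side "planted particle" reading.  The crux needs the WEAKEST such statement:

  stub 2′ `stub_quarticInfluence` (OPEN, the only `sorry`): QUARTIC EXERGY BOUND —
  `∫ |vᵢ|⁴ F(flip Φ_s z) dG ≤ C` uniformly in `N ≥ N₀`, `s ≤ t < T`, `i`
  (= a uniform quartic velocity moment `E_{λ_N}|vᵢ(s)|⁴ ≤ C` of the evolved law, pre-shock),

which docks to the crux by Chebyshev (`EnergyCurrentTails_of`, this file; landed as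
`…Theorems.LoschmidtTagging.stub_quarticInfluenceDocking`, p92711, through `stub_quarticDocking`,
p92098).  The card's original transfer statement C⁺ (`stub_exergyInfluence`, a Gaussian envelope tested
against EVERY `g`) is STRONGER: it is EQUIVALENT (`stub_marginalEnvelope_iff`, p91923) to an N-uniform
Gaussian envelope of the evolved one-particle velocity marginals and implies stub 2′
(`stub_quarticInfluence_of_exergyInfluence`, this file; landed as `…quarticInfluence_of_exergyInfluence`).
Hierarchy for the planner: crux ⟸ quartic moment (stub 2′) ⟸ Gaussian tail envelope ⟸ C⁺; all of
open-problem class (no N-uniform velocity-moment propagation for deterministic hard spheres at fixed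
density is known; every tree tool re-acquires a factor e^{Θ(N)}, Disproof §5).

## Disproof honoured (`Cruxes/EnergyCurrentTails/Disproof.lean`, cycle 1 v1)
§3 (randomness load-bearing): everything is about laws `F·G`; §4 (beyond quadratic UI): stub 2′ is a
genuine fourth-moment statement, false for the two-point focusing laws; §5 (no pathwise maximum
principle): nothing pathwise; §6 (exponential currency dead): no exponential moment anywhere in the
reshaped line (the Gaussian tilt only in the superseded C⁺); `EquilibriumRung.lean`: the `F ≡ 1` case,
landed with drift as stub 5.

## Stubs registered on the item (9): status
1. `stub_tagging` — CLOSED, landed `…EnergyCurrentTailsTagging.lean` (p85552).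
2. `stub_exergyInfluence` — the card's C⁺ (superseded by 2′; kept as a `def`, no `sorry`).
2′. `stub_quarticInfluence` — OPEN (the only `sorry`), held by the lead.
2′d. `stub_quarticInfluenceDocking` — CLOSED, landed `…EnergyCurrentTailsQuarticInfluence.lean` (p92711)
    (its proof is repeated inside `EnergyCurrentTails_of` below).
3. `stub_docking` (C⁺-docking) — CLOSED, landed `…EnergyCurrentTailsDocking.lean` (p91201).
4. `stub_exergyInfluence_initial` — CLOSED, landed `…EnergyCurrentTailsExergyInitial.lean` (p91811): C⁺ at `s = 0`.
5. `stub_equilibriumRung` — CLOSED, landed `…EnergyCurrentTailsEquilibrium.lean` (p91530): the crux for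
   constant profiles, any drift, no `N₀`, no horizon.
6. `stub_marginalEnvelope_iff` — CLOSED, landed `…EnergyCurrentTailsMarginalForm.lean` (p91923).
7. `stub_quarticDocking` — CLOSED, landed `…EnergyCurrentTailsQuarticDocking.lean` (p92098).
Composition: `EnergyCurrentTails_of (h : stub_quarticInfluence)` and the hypothesis-free
`EnergyCurrentTails_proof` / `_proof_oneFlight` conclude the crux BY NAME (modulo the one `sorry`).
-/

noncomputable section

open MeasureTheory Set Filter
open scoped ENNReal

namespace Summit.AtomisticToContinuum.HydrodynamicLimit.Cruxes.EnergyCurrentTails.IdeatorThreeSketch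

open Literature.MathematicalPhysics.KineticTheory Literature.Analysis.FluidPDE
open Summit.AtomisticToContinuum.HydrodynamicLimit.Theses.OneFlightGossipEngine

namespace Holds

/-- **Stub 1 — LOSCHMIDT TAGGING IDENTITY** (CLOSED, p85552).  For the homogeneous Gibbs law
`G = localGibbsLaw σ a 0 θ`, every flow `Φ`, every measurable `F ≥ 0`, every measurable EVEN `g ≥ 0`,
every time `s` and particle `i`: `∫ F(z)·g(vᵢ(Φ_s z)) dG = ∫ g(vᵢ(z))·F(flip(Φ_s z)) dG`. -/
theorem stub_tagging :
    ∀ (σ a θ : ℝ) (N : ℕ)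
      (Φ : HardSphereFlow (Torus.geometry (Fin 3)) (hsDiameter σ N) (N + 1))
      (F : Config (N + 1) (Fin 3) T3 → ℝ≥0∞), Measurable F →
      ∀ (g : V3 → ℝ≥0∞), Measurable g → (∀ v, g (-v) = g v) →
      ∀ (s : ℝ) (i : Fin (N + 1)),
        ∫⁻ z, F z * g ((Φ.flow s z i).2)
            ∂(localGibbsLaw σ (fun _ => a) (fun _ => 0) (fun _ => θ) N Φ)
          = ∫⁻ z, g ((z i).2) * F (flipVel (Φ.flow s z))
              ∂(localGibbsLaw σ (fun _ => a) (fun _ => 0) (fun _ => θ) N Φ) :=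
  Summit.AtomisticToContinuum.HydrodynamicLimit.Theorems.LoschmidtTagging.stub_tagging

/-- **Stub 2′ — QUARTIC EXERGY BOUND** (OPEN — the line's single open stub, held by the lead).
For every `t < T` there are `a, θr, C, N₀` such that for `N ≥ N₀`, `s ∈ [0,t]` the local Gibbs law
has a density `F` w.r.t. `G = localGibbsLaw σ a 0 θr` with `∫ |vᵢ|⁴ F(flip(Φ_s z)) dG ≤ C` for every
particle `i` — by the tagging identity, a uniform QUARTIC velocity moment `E_{λ_N}|vᵢ(s)|⁴ ≤ C` of
the evolved law before the first shock.  Weaker than the card's C⁺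
(`stub_quarticInfluence_of_exergyInfluence`) and than any Gaussian tail envelope; open-problem class. -/
theorem stub_quarticInfluence :
    ∀ (a₀ θ₀ : T3 → ℝ) (u₀ : T3 → V3), Continuous a₀ → Continuous θ₀ → Continuous u₀ →
      (∀ x, 0 < a₀ x) → (∀ x, 0 < θ₀ x) →
      ∃ σ₀ : ℝ, 0 < σ₀ ∧ ∀ σ : ℝ, 0 < σ → σ < σ₀ →
        ∀ (T : ℝ) (ρ θ : ℝ → T3 → ℝ) (u : ℝ → T3 → V3), IsHardSphereEulerSolution σ T ρ u θ →
          ∀ Φ : (N : ℕ) → HardSphereFlow (Torus.geometry (Fin 3)) (hsDiameter σ N) (N + 1),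
            TendstoHydroFieldsAt (fun N => localGibbsLaw σ a₀ u₀ θ₀ N (Φ N)) Φ ρ u θ 0 →
              ∀ t ∈ Set.Ico 0 T, ∃ a θr C : ℝ, 0 < a ∧ 0 < θr ∧ 0 ≤ C ∧
                ∃ N₀ : ℕ, ∀ N : ℕ, N₀ ≤ N → ∀ s ∈ Set.Icc 0 t,
                  ∃ F : Config (N + 1) (Fin 3) T3 → ℝ≥0∞, Measurable F ∧
                    localGibbsLaw σ a₀ u₀ θ₀ N (Φ N)
                      = (localGibbsLaw σ (fun _ => a) (fun _ => 0) (fun _ => θr) N (Φ N)).withDensity F ∧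
                    ∀ i : Fin (N + 1),
                      ∫⁻ z, ENNReal.ofReal (‖(z i).2‖ ^ 4) * F (flipVel ((Φ N).flow s z))
                          ∂(localGibbsLaw σ (fun _ => a) (fun _ => 0) (fun _ => θr) N (Φ N))
                        ≤ ENNReal.ofReal C := by
  sorry

/-- **Stub 4 — C⁺ at `s = 0`** (audit; CLOSED, p91811): under the local Gibbs DATA the (flipped)
one-particle velocity marginal has a Gaussian envelope w.r.t. the homogeneous reference, uniformly
in `N` (`σ₀ = 1/2`, `a = 1`, `θr = min θ₀`, `β = 1/θr − 1/(2 max θ₀)`, `C = exp(max‖u₀‖²/(2θr))`). -/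
theorem stub_exergyInfluence_initial :
    ∀ (a₀ θ₀ : T3 → ℝ) (u₀ : T3 → V3), Continuous a₀ → Continuous θ₀ → Continuous u₀ →
      (∀ x, 0 < a₀ x) → (∀ x, 0 < θ₀ x) →
      ∃ σ₀ : ℝ, 0 < σ₀ ∧ ∀ σ : ℝ, 0 < σ → σ < σ₀ →
        ∀ Φ : (N : ℕ) → HardSphereFlow (Torus.geometry (Fin 3)) (hsDiameter σ N) (N + 1),
          ∃ a θr β C : ℝ, 0 < a ∧ 0 < θr ∧ β * θr < 1 ∧ 0 ≤ C ∧
            ∃ N₀ : ℕ, ∀ N : ℕ, N₀ ≤ N →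
              ∃ F : Config (N + 1) (Fin 3) T3 → ℝ≥0∞, Measurable F ∧
                localGibbsLaw σ a₀ u₀ θ₀ N (Φ N)
                  = (localGibbsLaw σ (fun _ => a) (fun _ => 0) (fun _ => θr) N (Φ N)).withDensity F ∧
                ∀ (i : Fin (N + 1)) (g : V3 → ℝ≥0∞), Measurable g →
                  ∫⁻ z, g ((z i).2) * F (flipVel ((Φ N).flow 0 z))
                      ∂(localGibbsLaw σ (fun _ => a) (fun _ => 0) (fun _ => θr) N (Φ N))
                    ≤ ENNReal.ofReal C *
                      ∫⁻ z, g ((z i).2) * ENNReal.ofReal (Real.exp (β * ‖(z i).2‖ ^ 2 / 2))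
                        ∂(localGibbsLaw σ (fun _ => a) (fun _ => 0) (fun _ => θr) N (Φ N)) :=
  Summit.AtomisticToContinuum.HydrodynamicLimit.Theorems.LoschmidtTagging.stub_exergyInfluence_initial

/-- **Stub 5 — EQUILIBRIUM RUNG** (audit; CLOSED, p91530): the crux's conclusion for CONSTANT
profiles `(a, u, θ̄)` with any constant drift `u`, every `0 < σ < 1/2`, every flow family, one
cut-off `M` for ALL `N` and ALL `s` (invariance of the homogeneous Gibbs law + static Gaussian tail). -/
theorem stub_equilibriumRung :
    ∀ (σ a θb : ℝ) (u : V3), 0 < σ → σ < 1 / 2 → 0 < a → 0 < θb →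
      ∀ (Φ : (N : ℕ) → HardSphereFlow (Torus.geometry (Fin 3)) (hsDiameter σ N) (N + 1)) (ε : ℝ),
        0 < ε → ∃ M : ℝ, ∀ (N : ℕ) (s : ℝ),
          ∫⁻ z, ENNReal.ofReal (((N : ℝ) + 1)⁻¹ * ∑ i : Fin (N + 1),
              Set.indicator {v : V3 | M < ‖v‖} (fun v => ‖v‖ ^ 3) (((Φ N).flow s z i).2))
            ∂(localGibbsLaw σ (fun _ => a) (fun _ => u) (fun _ => θb) N (Φ N)) ≤ ENNReal.ofReal ε :=
  Summit.AtomisticToContinuum.HydrodynamicLimit.Theorems.LoschmidtTagging.stub_equilibriumRung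

end Holds

/-! ## Stub statements by name (D-0027 §3.3) -/

/-- Statement of stub 1 (`Holds.stub_tagging`), by name. -/
def stub_tagging : Prop := type_of% Holds.stub_tagging
/-- Statement of stub 2′ (`Holds.stub_quarticInfluence`), by name — THE open stub. -/
def stub_quarticInfluence : Prop := type_of% Holds.stub_quarticInfluence
/-- Statement of stub 4 (`Holds.stub_exergyInfluence_initial`), by name. -/
def stub_exergyInfluence_initial : Prop := type_of% Holds.stub_exergyInfluence_initial
/-- Statement of stub 5 (`Holds.stub_equilibriumRung`), by name. -/
def stub_equilibriumRung : Prop := type_of% Holds.stub_equilibriumRung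

/-- Stub 2 — the card's transfer statement C⁺ (EXERGY INFLUENCE BOUND; registered; superseded by 2′
after the cycle-1 reshape, so no `sorry` is kept for it).  In the frame of the crux: for every `t < T`
there are a homogeneous reference `G = localGibbsLaw σ a 0 θr`, a rate `β` with `βθr < 1`, a constant
`C` and `N₀` such that for `N ≥ N₀`, `s ∈ [0,t]` the local Gibbs law has a density `F` w.r.t. `G` and,
tested against every one-particle velocity observable `g ≥ 0`,
`∫ g(vᵢ) F(flip(Φ_s z)) dG ≤ C ∫ g(vᵢ) e^{β|vᵢ|²/2} dG` — EQUIVALENT (stub 6) to an N-uniform Gaussian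
envelope of the evolved one-particle velocity marginals. -/
def stub_exergyInfluence : Prop :=
    ∀ (a₀ θ₀ : T3 → ℝ) (u₀ : T3 → V3), Continuous a₀ → Continuous θ₀ → Continuous u₀ →
      (∀ x, 0 < a₀ x) → (∀ x, 0 < θ₀ x) →
      ∃ σ₀ : ℝ, 0 < σ₀ ∧ ∀ σ : ℝ, 0 < σ → σ < σ₀ →
        ∀ (T : ℝ) (ρ θ : ℝ → T3 → ℝ) (u : ℝ → T3 → V3), IsHardSphereEulerSolution σ T ρ u θ →
          ∀ Φ : (N : ℕ) → HardSphereFlow (Torus.geometry (Fin 3)) (hsDiameter σ N) (N + 1),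
            TendstoHydroFieldsAt (fun N => localGibbsLaw σ a₀ u₀ θ₀ N (Φ N)) Φ ρ u θ 0 →
              ∀ t ∈ Set.Ico 0 T, ∃ a θr β C : ℝ, 0 < a ∧ 0 < θr ∧ β * θr < 1 ∧ 0 ≤ C ∧
                ∃ N₀ : ℕ, ∀ N : ℕ, N₀ ≤ N → ∀ s ∈ Set.Icc 0 t,
                  ∃ F : Config (N + 1) (Fin 3) T3 → ℝ≥0∞, Measurable F ∧
                    localGibbsLaw σ a₀ u₀ θ₀ N (Φ N)
                      = (localGibbsLaw σ (fun _ => a) (fun _ => 0) (fun _ => θr) N (Φ N)).withDensity F ∧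
                    ∀ (i : Fin (N + 1)) (g : V3 → ℝ≥0∞), Measurable g →
                      ∫⁻ z, g ((z i).2) * F (flipVel ((Φ N).flow s z))
                          ∂(localGibbsLaw σ (fun _ => a) (fun _ => 0) (fun _ => θr) N (Φ N))
                        ≤ ENNReal.ofReal C *
                          ∫⁻ z, g ((z i).2) * ENNReal.ofReal (Real.exp (β * ‖(z i).2‖ ^ 2 / 2))
                            ∂(localGibbsLaw σ (fun _ => a) (fun _ => 0) (fun _ => θr) N (Φ N))


/-- Stub 3 — docking of C⁺ (registered; CLOSED: `…Theorems.LoschmidtTagging.stub_docking`, p91201),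
statement by name. -/
def stub_docking : Prop := stub_tagging → stub_exergyInfluence → EnergyCurrentTails

/-- Stub 2′d — docking of the quartic exergy bound (registered; CLOSED:
`…Theorems.LoschmidtTagging.stub_quarticInfluenceDocking`, p92711), statement by name. -/
def stub_quarticInfluenceDocking : Prop := stub_quarticInfluence → EnergyCurrentTails

/-- Stub 6 (audit; CLOSED p91923), by name: MARGINAL ENVELOPE ⟺ C⁺. -/
def stub_marginalEnvelope_iff : Prop :=
  type_of% Summit.AtomisticToContinuum.HydrodynamicLimit.Theorems.LoschmidtTagging.stub_marginalEnvelope_iff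

/-- Stub 7 (audit; CLOSED p92098), by name: uniform empirical quartic moment along the flow ⟹ crux. -/
def stub_quarticDocking : Prop :=
  type_of% Summit.AtomisticToContinuum.HydrodynamicLimit.Theorems.LoschmidtTagging.stub_quarticDocking

/-- Certificate: stub 6 holds (landed). -/
theorem stub_marginalEnvelope_iff_holds : stub_marginalEnvelope_iff :=
  Summit.AtomisticToContinuum.HydrodynamicLimit.Theorems.LoschmidtTagging.stub_marginalEnvelope_iff

/-! ## Composition (sorry-free): the open stub ⟹ the crux BY NAME -/

/-- **THE SKELETON THEOREM.**  The quartic exergy bound (stub 2′, the only open stub) implies the crux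
(primary copy `WarmColdDichotomy.EnergyCurrentTails`, definitionally the same `Prop` as the
`OneFlightGossipEngine` copy): the tested quartic functional IS `E_{λ_N}|vᵢ(s)|⁴`
(`lintegral_mul_density_flipVel_flow`, landed), so the empirical quartic moment along the flow is
`≤ C`, and the landed quartic docking (`stub_quarticDocking`: Chebyshev, `M = |C|/ε + 1`) concludes.
(Same proof as the landed `…LoschmidtTagging.stub_quarticInfluenceDocking`, p92711, repeated here so
that the skeleton's hypotheses are exactly the declared open stub.) -/
theorem EnergyCurrentTails_of (hQI : stub_quarticInfluence) :
    Summit.AtomisticToContinuum.HydrodynamicLimit.Theses.WarmColdDichotomy.EnergyCurrentTails := by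
  have hQI' : type_of% Holds.stub_quarticInfluence := hQI
  clear hQI
  show Summit.AtomisticToContinuum.HydrodynamicLimit.Theses.OneFlightGossipEngine.EnergyCurrentTails
  revert hQI'
  intro hQI
  refine Summit.AtomisticToContinuum.HydrodynamicLimit.Theorems.LoschmidtTagging.stub_quarticDocking ?_
  intro a₀ θ₀ u₀ ha hθ hu ha0 hθ0
  obtain ⟨σ₀, hσ₀, H⟩ := hQI a₀ θ₀ u₀ ha hθ hu ha0 hθ0
  refine ⟨σ₀, hσ₀, fun σ hσ hσlt T ρ θ u hE Φ h0 t ht => ?_⟩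
  obtain ⟨a, θr, C, _ha, _hθr, hC, N₀, HN⟩ := H σ hσ hσlt T ρ θ u hE Φ h0 t ht
  refine ⟨C, N₀, fun N hN s hs => ?_⟩
  obtain ⟨F, hFm, hFeq, Hi⟩ := HN N hN s hs
  -- the quartic observable, as an `ℝ≥0∞`-valued one-particle function
  have hg : Measurable fun w : V3 => ENNReal.ofReal (‖w‖ ^ 4) :=
    (measurable_norm.pow_const 4).ennreal_ofReal
  -- each particle's quartic moment under the evolved law is the tested functional, hence `≤ C`
  have hpart : ∀ i : Fin (N + 1),
      ∫⁻ w, ENNReal.ofReal (‖((Φ N).flow s w i).2‖ ^ 4) ∂(localGibbsLaw σ a₀ u₀ θ₀ N (Φ N))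
        ≤ ENNReal.ofReal C := by
    intro i
    have hid :=
      Summit.AtomisticToContinuum.HydrodynamicLimit.Theorems.LoschmidtTagging.lintegral_mul_density_flipVel_flow
        σ a θr N (Φ N) hFm hg s i
    simp only [norm_neg] at hid
    rw [← hFeq] at hid
    rw [← hid]
    exact Hi i
  -- sum over particles
  have hvel : ∀ i : Fin (N + 1), Measurable fun w : Config (N + 1) (Fin 3) T3 =>
      ENNReal.ofReal (‖((Φ N).flow s w i).2‖ ^ 4) := fun i =>
    hg.comp (measurable_snd.comp ((measurable_pi_apply i).comp ((Φ N).measurable_flow s)))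
  have hpt : ∀ z : Config (N + 1) (Fin 3) T3,
      ENNReal.ofReal (((N : ℝ) + 1)⁻¹ * ∑ i : Fin (N + 1), ‖((Φ N).flow s z i).2‖ ^ 4) =
        ENNReal.ofReal (((N : ℝ) + 1)⁻¹) *
          ∑ i : Fin (N + 1), ENNReal.ofReal (‖((Φ N).flow s z i).2‖ ^ 4) := by
    intro z
    rw [ENNReal.ofReal_mul (by positivity), ENNReal.ofReal_sum_of_nonneg fun i _ => by positivity]
  have hN : ENNReal.ofReal (((N : ℝ) + 1)⁻¹) * ((N + 1 : ℕ) : ℝ≥0∞) = 1 := by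
    rw [ENNReal.ofReal_inv_of_pos (by positivity)]
    have : ENNReal.ofReal ((N : ℝ) + 1) = ((N + 1 : ℕ) : ℝ≥0∞) := by
      rw [show ((N : ℝ) + 1) = ((N + 1 : ℕ) : ℝ) by push_cast; ring, ENNReal.ofReal_natCast]
    rw [this]
    exact ENNReal.inv_mul_cancel (by simp) (ENNReal.natCast_ne_top _)
  calc ∫⁻ z, ENNReal.ofReal (((N : ℝ) + 1)⁻¹ * ∑ i : Fin (N + 1), ‖((Φ N).flow s z i).2‖ ^ 4)
        ∂(localGibbsLaw σ a₀ u₀ θ₀ N (Φ N))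
      = ∫⁻ z, ENNReal.ofReal (((N : ℝ) + 1)⁻¹) *
          ∑ i : Fin (N + 1), ENNReal.ofReal (‖((Φ N).flow s z i).2‖ ^ 4)
          ∂(localGibbsLaw σ a₀ u₀ θ₀ N (Φ N)) := lintegral_congr fun z => hpt z
    _ = ENNReal.ofReal (((N : ℝ) + 1)⁻¹) *
          ∫⁻ z, ∑ i : Fin (N + 1), ENNReal.ofReal (‖((Φ N).flow s z i).2‖ ^ 4)
            ∂(localGibbsLaw σ a₀ u₀ θ₀ N (Φ N)) :=
        lintegral_const_mul _ (Finset.measurable_sum _ fun i _ => hvel i)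
    _ = ENNReal.ofReal (((N : ℝ) + 1)⁻¹) *
          ∑ i : Fin (N + 1), ∫⁻ z, ENNReal.ofReal (‖((Φ N).flow s z i).2‖ ^ 4)
            ∂(localGibbsLaw σ a₀ u₀ θ₀ N (Φ N)) := by
        congr 1
        exact lintegral_finsetSum _ fun i _ => hvel i
    _ ≤ ENNReal.ofReal (((N : ℝ) + 1)⁻¹) * ∑ _i : Fin (N + 1), ENNReal.ofReal C := by
        gcongr with i
        exact hpart i
    _ = ENNReal.ofReal C := by
        rw [Finset.sum_const, Finset.card_univ, Fintype.card_fin, nsmul_eq_mul, ← mul_assoc, hN,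
          one_mul]

/-- **The line's closing theorem, modulo the registered stubs** (primary copy of the item; sorry-free
once stub 2′ is): the declaration the gate probes. -/
theorem EnergyCurrentTails_proof :
    Summit.AtomisticToContinuum.HydrodynamicLimit.Theses.WarmColdDichotomy.EnergyCurrentTails :=
  EnergyCurrentTails_of Holds.stub_quarticInfluence

/-- The same closing theorem for the route copy `OneFlightGossipEngine.EnergyCurrentTails`. -/
theorem EnergyCurrentTails_proof_oneFlight :
    Summit.AtomisticToContinuum.HydrodynamicLimit.Theses.OneFlightGossipEngine.EnergyCurrentTails :=
  EnergyCurrentTails_of Holds.stub_quarticInfluence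

/-! ## The card's path survives the reshape: C⁺ ⟹ stub 2′ -/

/-- **The card's C⁺ implies the quartic exergy bound** (so the reshaped open stub is WEAKER than the
card's): test C⁺ with `g = |·|⁴`; the tilted quartic Gaussian moment is finite for `βθr < 1`
(`lintegral_norm_pow_four_mul_exp_lt_top`, landed), after shrinking `σ₀` to `≤ 1/2`
(`lintegral_vel_localGibbsLaw_const`).  (Landed as `…LoschmidtTagging.quarticInfluence_of_exergyInfluence`,
p92711; repeated here.) -/
theorem stub_quarticInfluence_of_exergyInfluence (h2 : stub_exergyInfluence) : stub_quarticInfluence := by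
  show type_of% Holds.stub_quarticInfluence
  intro a₀ θ₀ u₀ ha hθ hu ha0 hθ0
  obtain ⟨σ₀, hσ₀, H⟩ := h2 a₀ θ₀ u₀ ha hθ hu ha0 hθ0
  refine ⟨min σ₀ (1 / 2), lt_min hσ₀ (by norm_num), ?_⟩
  intro σ hσ hσlt T ρ θ u hE Φ h0 t ht
  have hσ₀' : σ < σ₀ := lt_of_lt_of_le hσlt (min_le_left _ _)
  have hσ2 : σ ≤ 1 / 2 := (lt_of_lt_of_le hσlt (min_le_right _ _)).le
  obtain ⟨a, θr, β, C, ha', hθr, hβ, hC, N₀, HN⟩ := H σ hσ hσ₀' T ρ θ u hE Φ h0 t ht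
  -- the finite tilted quartic Gaussian moment
  set K₄ : ℝ≥0∞ := ∫⁻ w, ENNReal.ofReal (‖w‖ ^ 4) * ENNReal.ofReal (Real.exp (β * ‖w‖ ^ 2 / 2))
    ∂(gaussMeasure (0 : V3) θr) with hK₄
  have hK₄top : K₄ ≠ ⊤ := (Summit.AtomisticToContinuum.HydrodynamicLimit.Theorems.LoschmidtTagging.lintegral_norm_pow_four_mul_exp_lt_top hθr hβ).ne
  refine ⟨a, θr, C * K₄.toReal, ha', hθr, mul_nonneg hC ENNReal.toReal_nonneg, N₀,
    fun N hN s hs => ?_⟩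
  obtain ⟨F, hFm, hFeq, Hg⟩ := HN N hN s hs
  refine ⟨F, hFm, hFeq, fun i => ?_⟩
  have hg : Measurable fun w : V3 => ENNReal.ofReal (‖w‖ ^ 4) :=
    (measurable_norm.pow_const 4).ennreal_ofReal
  have hHm : Measurable (fun w : V3 =>
      ENNReal.ofReal (‖w‖ ^ 4) * ENNReal.ofReal (Real.exp (β * ‖w‖ ^ 2 / 2))) :=
    hg.mul (((measurable_norm.pow_const 2).const_mul β).div_const 2).exp.ennreal_ofReal
  have key := Hg i (fun w => ENNReal.ofReal (‖w‖ ^ 4)) hg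
  rw [Summit.AtomisticToContinuum.HydrodynamicLimit.Theorems.LoschmidtTagging.lintegral_vel_localGibbsLaw_const
    hσ2 ha' hθr N (Φ N) i hHm] at key
  calc ∫⁻ z, ENNReal.ofReal (‖(z i).2‖ ^ 4) * F (flipVel ((Φ N).flow s z))
          ∂(localGibbsLaw σ (fun _ => a) (fun _ => 0) (fun _ => θr) N (Φ N))
      ≤ ENNReal.ofReal C * K₄ := key
    _ = ENNReal.ofReal (C * K₄.toReal) := by
        rw [ENNReal.ofReal_mul hC, ENNReal.ofReal_toReal hK₄top]

end Summit.AtomisticToContinuum.HydrodynamicLimit.Cruxes.EnergyCurrentTails.IdeatorThreeSketch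

end
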